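import Literature.Computability.Cryptography.LatticeOWFProofs
import Literature.Algebra.EuclideanLattices.GapSVPFromDualSets
import Literature.Algebra.EuclideanLattices.LLLMachineMain
import Literature.Computability.Complexity.PlumbingBricks
import Literature.Computability.Complexity.ListFoldBricks
import Literature.Computability.Complexity.CountingHierarchyProofs
import Literature.Computability.Complexity.BPPErrorReduction
import HarnessLib

/-!
# `GapSVP` with polynomial factors from short dual sets: the verifier-free route to `owfExist_of_gapSVP_worstCaseHard`

Topic `Computability/Cryptography` (family `pqc`). Part of the decomposition of the named fact
`Literature.Computability.Cryptography.owfExist_of_gapSVP_worstCaseHard` (`LatticeOWF.lean`: worst-case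
hardness of `GapSVP_γ` for ALL polynomially bounded `γ`, infinitely-often / promise-BPP′ form, gives
one-way functions). The tree reduces that fact (`owfExist_of_gapSVP_worstCaseHard_of_one`,
`LatticeOWFProofs.lean`) to Micciancio–Regev's Theorem 5.23 proper (`GapCVP′_{14π√n β} → SIS′`). The
printed proof of Thm. 5.23 (authors' version p. 29) STARTS with "using Corollary 5.13 (with `F` as an
oracle), we obtain a set of `n` linearly independent vectors `S` in `L(B)*` such that
`‖S‖ ≤ 8β√n η_ε(B*)`" and then spends §5.4 (the procedure `W`, the Aharonov–Regev verifier `V` with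
its cosine and eigenvalue tests, Hoeffding's bound (14), Lemma 5.20, eqs. (15)–(20)) on squeezing the
factor down to `14π√n β`. Since the target fact quantifies over EVERY polynomial factor, that first
step alone suffices, with the factor `γ = 8βn`, by the transference test of
`Algebra/EuclideanLattices/GapSVPFromDualSets.lean` (a dual set always has `‖S‖ ≥ 1/λ₁(L)`; on a NO
instance `‖S‖ ≤ 8β√n η_{2⁻ⁿ}(L*) ≤ 8βn/λ₁(L) < 1/d` by MR07 Lemma 3.2). This file makes that route
formal, everything PROVED:

* `givpDualOutputs I g` — the good outputs of a GIVP solver run on the dual lattice of the instance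
  `I = (n, B)`: strings `⟨bin D, code of (n, U)⟩` (`U ∈ ℤⁿˣⁿ`, `D ≥ 1`) such that the rows `uᵢ/D` lie in
  `L(B)*`, are linearly independent, and have norm `≤ g · η_{2⁻ⁿ}(L(B)*)`;
* the DECIDER `GIVPDual.decF R p` (an `FP` string function assembled from the tree's bricks — no Turing
  machine by hand): on `⟨⟨code of (B, d)⟩, y⟩` it runs `R` on the code of `B` with the coins
  `y ↾ p(|code B|)`, parses the answer `⟨bin D, code (n, U)⟩` with the LLL machine's parser
  (`LLLMachine.parseF`), and accepts iff `D² den(d)² ≤ num(d)² ‖uᵢ‖²` for some row (`LLLMachine.dotF`,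
  `zmulF`, `zleF`, `anyFn`); `decF_apply` computes its bit on genuine data and `decLang_mem_P` puts the
  accepted language in `P`;
* `gapSVP_restrict_mem_PromiseBPP'_of_givpDual` — if a PPT `R` (coin budget a polynomial `p`) outputs a
  good dual set with probability `≥ 2/3` on every nonsingular instance of dimension `n ∈ S'`
  (`S' ⊆ [1, ∞)`), with `g(n)√n ≤ γ(n)`, then `GapSVP_γ` restricted to dimensions in `S'` is in textbook
  promise-BPP (`PromiseBPP'`): witness language `decLang R p`, coin polynomial `p`; the probability is
  transported by `RandAlg.pr_eq_uniformProb`, the cylinder rule `uniformProb_take_of_le` and the two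
  test lemmas `LatticeInstance.gapSVP_dualTest_of_yes/_of_no`;
* **`owfExist_of_gapSVP_worstCaseHard_of_givpDual`** — the target fact from ONE hypothesis, written
  INLINE (no new named fact, D-0026): Micciancio–Regev's **Corollary 5.13 applied to the dual lattice**
  exactly as invoked on p. 29 — under the parameter hypotheses of Thm. 5.23 (`IsPolyTimeParams`,
  `MRModulusCondition`, which implies Cor. 5.13's `q ≥ 8n√m β` for `n ≥ 4`), every PPT SIS′ solver `B`
  succeeding with probability `≥ 1/n^c` on the dimensions `n ∈ S` yields a PPT `R` (polynomial coin
  budget) that, on the code of a nonsingular `B` of dimension `n ∈ S`, `n ≥ n₀`, outputs with probability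
  `≥ 2/3` a good dual set with `g = 8β(n)√n`. The assembly is that of
  `owfExist_of_gapSVP_worstCaseHard_of_MR07` with F2 discharged (`Ajtai1996_sisFunction_inverter_to_SIS'_holds`)
  and the factor `γ(n) = max 1 (8 β(n) n)`.

So, along this route, what separates `owfExist_of_gapSVP_worstCaseHard` from a proof is exactly the
machine-level Cor. 5.13 (= Thm. 5.9, the `IncGDD → SIS` reduction with the sampling and combining
procedures of Lemmas 5.7–5.8, iterated by Lemma 5.10) — a strict sub-task of Thm. 5.23 proper, whose
remaining §5.4 (verifier, `W`, Hoeffding, Lemma 5.20) and Lemma 5.22 (GMSS) are not needed here.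

## References

* D. Micciancio, O. Regev, *Worst-case to average-case reductions based on Gaussian measures*,
  SIAM J. Comput. 37 (2007) 267–302; authors' version (`lit read doi:10.1137/S0097539705447360`):
  Lemma 3.2 (p. 11), Thm. 5.9 (p. 22), Lemma 5.10 and Cor. 5.13 (pp. 24–25), Thm. 5.23 and the first
  step of its proof (pp. 28–29).
* M. Ajtai, *Generating hard instances of lattice problems*, STOC 1996, Thm. 1.
* O. Goldreich, *On promise problems: a survey*, LNCS 3895 (2006), Def. 1.2 (promise-BPP).
* S. Arora, B. Barak, *Computational Complexity: A Modern Approach*, CUP 2009, §1.3, §7.1.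
-/

noncomputable section

namespace Literature.Computability.Cryptography

open _root_.Computability Polynomial Filter Literature.Computability.Complexity
  Literature.Computability.Complexity.Brick Literature.Algebra.EuclideanLattices
  Literature.Algebra.EuclideanLattices.LLLMachine Literature.Computability.Cryptography.LWE

/-! ### Good outputs of a GIVP solver on the dual lattice -/

/-- The good outputs of a solver for `GIVP` run on the DUAL of the lattice instance `I = (n, B)`, with
quality `g`: strings `boolPair (encodeNat D) (LatticeInstance.encode ⟨n, U⟩)` with `D ≥ 1` and
`U ∈ ℤⁿˣⁿ` whose rows `uᵢ/D` belong to `L(B)*`, are linearly independent over `ℝ`, and satisfy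
`‖uᵢ/D‖ ≤ g · η_{2⁻ⁿ}(L(B)*)` (Micciancio–Regev’s GIVP^{η_ε}_g, Def. 2.6 with φ = η_ε, Cor. 5.13; here for the dual lattice
and `ε = 2⁻ⁿ` as fixed in the proof of Thm. 5.23, p. 29; dual vectors are rational, written over a
common denominator). [cite: MicciancioRegev2007, Cor. 5.13 (GIVP; applied to L(B)* on p. 29)] -/
def givpDualOutputs (I : LatticeInstance) (g : ℝ) : Set (List Bool) :=
  {w | ∃ (D : ℕ) (U : Matrix (Fin I.n) (Fin I.n) ℤ),
      w = boolPair (encodeNat D) (LatticeInstance.encode ⟨I.n, U⟩) ∧ 0 < D ∧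
      (∀ i, (D : ℝ)⁻¹ • intVecToEuclidean I.n (U i) ∈ dualLattice I.lattice) ∧
      LinearIndependent ℝ (fun i => intVecToEuclidean I.n (U i)) ∧
      ∀ i, ‖(D : ℝ)⁻¹ • intVecToEuclidean I.n (U i)‖ ≤
        g * smoothingParameter (dualLattice I.lattice) ((2⁻¹ : ℝ) ^ I.n)}

/-! ### The decider machine -/

namespace GIVPDual

variable (R : RandAlg (List Bool) (List Bool)) (p : Polynomial ℕ)

/-- The code of the lattice instance: field `⟨⟨ic, rc⟩, y⟩ ↦ ic`. [folklore] -/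
def IC : List Bool → List Bool := fstF ∘ fstF

/-- The numerator of the threshold `d` as a canonical integer code (`ofSMFn` of the sign–magnitude
entry of `encodeRat d`). [folklore] -/
def NUMF : List Bool → List Bool := ofSMFn ∘ fstF ∘ sndF ∘ fstF

/-- The denominator of `d` as a difference pair `⟨bin den, ε⟩`. [folklore] -/
def DENF : List Bool → List Bool := fanoutFn (sndF ∘ sndF ∘ fstF) fun _ => []

/-- The coins handed to `R`: `y ↾ p(|ic|)`. [folklore] -/
def COINS : List Bool → List Bool := Plumb.takeFn ∘ fanoutFn (Plumb.polyFn p ∘ IC) sndF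

/-- The answer of `R` on the instance code with those coins. [folklore] -/
def OUT : List Bool → List Bool := (Function.uncurry R.run ∘ boolUnpair) ∘ fanoutFn IC (COINS p)

/-- The common denominator `D` of the answer, as a difference pair `⟨bin D, ε⟩`. [folklore] -/
def DF : List Bool → List Bool := fanoutFn (fstF ∘ OUT R p) fun _ => []

/-- The matrix part of the answer, parsed by the LLL machine's parser:
`⟨yardstick, ⟨bin n, matCode U⟩⟩`. [folklore] -/
def MREC : List Bool → List Bool := parseF ∘ sndF ∘ OUT R p

/-- `num(d)²`. [folklore] -/
def A2 : List Bool → List Bool := zmulF ∘ fanoutFn NUMF NUMF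

/-- The threshold `D² den(d)²`. [folklore] -/
def TT : List Bool → List Bool :=
  zmulF ∘ fanoutFn (zmulF ∘ fanoutFn (DF R p) (DF R p)) (zmulF ∘ fanoutFn DENF DENF)

/-- The context record of the row test: `⟨yardstick, ⟨bin n, ⟨num², D² den²⟩⟩⟩`. [folklore] -/
def CTX : List Bool → List Bool :=
  fanoutFn (nthF 0 ∘ MREC R p) (fanoutFn (nthF 1 ∘ MREC R p) (fanoutFn A2 (TT R p)))

/-- The squared norm of a row, on `⟨ctx, rowCode u⟩`: `dotF ⟨yard, ⟨bin n, ⟨row, row⟩⟩⟩`. [folklore] -/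
def dualRowDot : List Bool → List Bool :=
  dotF ∘ fanoutFn (nthF 0 ∘ fstF) (fanoutFn (nthF 1 ∘ fstF) (fanoutFn sndF sndF))

/-- The row test `[D² den² ≤ num² ‖u‖²]` on `⟨ctx, rowCode u⟩`. [folklore] -/
def dualRowTest : List Bool → List Bool :=
  zleF ∘ fanoutFn (sndPow 2 ∘ fstF) (zmulF ∘ fanoutFn (nthF 2 ∘ fstF) dualRowDot)

/-- **The decider**: accept iff some row of the answer passes the row test. [cite: MicciancioRegev2007, proof of Thm. 5.23, first step (p. 29)] -/
def decF : List Bool → List Bool := anyFn dualRowTest ∘ fanoutFn (CTX R p) (sndPow 1 ∘ MREC R p)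

/-! #### Membership in `FP` -/

/-- `IC ∈ FP`. [folklore] -/
theorem IC_mem_FP : IC ∈ FP := comp_mem_FP fstF_mem_FP fstF_mem_FP

/-- `NUMF ∈ FP`. [folklore] -/
theorem NUMF_mem_FP : NUMF ∈ FP :=
  comp_mem_FP ofSMFn_mem_FP (comp_mem_FP fstF_mem_FP (comp_mem_FP sndF_mem_FP fstF_mem_FP))

/-- `DENF ∈ FP`. [folklore] -/
theorem DENF_mem_FP : DENF ∈ FP :=
  fanoutFn_mem_FP (comp_mem_FP sndF_mem_FP (comp_mem_FP sndF_mem_FP fstF_mem_FP)) (const_mem_FP _)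

/-- `COINS p ∈ FP`. [folklore] -/
theorem COINS_mem_FP : COINS p ∈ FP :=
  comp_mem_FP Plumb.takeFn_mem_FP (fanoutFn_mem_FP (comp_mem_FP (Plumb.polyFn_mem_FP p) IC_mem_FP) sndF_mem_FP)

/-- `OUT R p ∈ FP` for a PPT `R` (its run map read through the pair decoder is polynomial-time).
[cite: AroraBarak2009, §1.3 and Def. 7.1] -/
theorem OUT_mem_FP (hR : IsPPT R id) : OUT R p ∈ FP :=
  comp_mem_FP (PolyTimeComputable.comp_holds hR.1 polyTimeComputable_boolUnpair)
    (fanoutFn_mem_FP IC_mem_FP (COINS_mem_FP p))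

/-- `DF R p ∈ FP`. [folklore] -/
theorem DF_mem_FP (hR : IsPPT R id) : DF R p ∈ FP :=
  fanoutFn_mem_FP (comp_mem_FP fstF_mem_FP (OUT_mem_FP R p hR)) (const_mem_FP _)

/-- `MREC R p ∈ FP`. [folklore] -/
theorem MREC_mem_FP (hR : IsPPT R id) : MREC R p ∈ FP :=
  comp_mem_FP parseF_mem_FP (comp_mem_FP sndF_mem_FP (OUT_mem_FP R p hR))

/-- `A2 ∈ FP`. [folklore] -/
theorem A2_mem_FP : A2 ∈ FP := comp_mem_FP zmulF_mem_FP (fanoutFn_mem_FP NUMF_mem_FP NUMF_mem_FP)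

/-- `TT R p ∈ FP`. [folklore] -/
theorem TT_mem_FP (hR : IsPPT R id) : TT R p ∈ FP :=
  comp_mem_FP zmulF_mem_FP (fanoutFn_mem_FP
    (comp_mem_FP zmulF_mem_FP (fanoutFn_mem_FP (DF_mem_FP R p hR) (DF_mem_FP R p hR)))
    (comp_mem_FP zmulF_mem_FP (fanoutFn_mem_FP DENF_mem_FP DENF_mem_FP)))

/-- `CTX R p ∈ FP`. [folklore] -/
theorem CTX_mem_FP (hR : IsPPT R id) : CTX R p ∈ FP :=
  fanoutFn_mem_FP (comp_mem_FP (nthF_mem_FP 0) (MREC_mem_FP R p hR))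
    (fanoutFn_mem_FP (comp_mem_FP (nthF_mem_FP 1) (MREC_mem_FP R p hR))
      (fanoutFn_mem_FP A2_mem_FP (TT_mem_FP R p hR)))

/-- `dualRowDot ∈ FP`. [folklore] -/
theorem dualRowDot_mem_FP : dualRowDot ∈ FP :=
  comp_mem_FP dotF_mem_FP (fanoutFn_mem_FP (comp_mem_FP (nthF_mem_FP 0) fstF_mem_FP)
    (fanoutFn_mem_FP (comp_mem_FP (nthF_mem_FP 1) fstF_mem_FP) (fanoutFn_mem_FP sndF_mem_FP sndF_mem_FP)))

/-- `dualRowTest ∈ FP`. [folklore] -/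
theorem dualRowTest_mem_FP : dualRowTest ∈ FP :=
  comp_mem_FP zleF_mem_FP (fanoutFn_mem_FP (comp_mem_FP (sndPow_mem_FP 2) fstF_mem_FP)
    (comp_mem_FP zmulF_mem_FP (fanoutFn_mem_FP (comp_mem_FP (nthF_mem_FP 2) fstF_mem_FP) dualRowDot_mem_FP)))

/-- The row test is one-bit on every input. [folklore] -/
theorem oneBit_dualRowTest : OneBit dualRowTest := oneBit_zleF.comp _

/-- `decF R p ∈ FP`. [cite: AroraBarak2009, §1.3 (polynomial time is closed under composition and bounded loops)] -/
theorem decF_mem_FP (hR : IsPPT R id) : decF R p ∈ FP :=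
  comp_mem_FP (anyFn_mem_FP dualRowTest_mem_FP oneBit_dualRowTest)
    (fanoutFn_mem_FP (CTX_mem_FP R p hR) (comp_mem_FP (sndPow_mem_FP 1) (MREC_mem_FP R p hR)))

/-- The decider is one-bit on every input. [folklore] -/
theorem oneBit_decF : OneBit (decF R p) := (oneBit_anyFn oneBit_dualRowTest).comp _

/-! #### Values on genuine data -/

/-- The code of a `GapSVP` instance is the pair of the instance code and the code of the threshold.
[cite: MicciancioGoldwasser2002, Ch. 1  Def. 1.4 / §1.2] -/
theorem gapSVP_encode_eq (I : LatticeInstance) (d : ℚ) :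
    gapSVPInstanceEncoding.encode (I, d) =
      boolPair I.encode (boolPair (boolPair [decide (d.num < 0)] (encodeNat d.num.natAbs)) (encodeNat d.den)) := rfl

section Values

variable (I : LatticeInstance) (d : ℚ) (y : List Bool)

/-- The input record of the decider on a genuine instance. [folklore] -/
def inp : List Bool := boolPair (gapSVPInstanceEncoding.encode (I, d)) y

/-- The coins field of the input record. [folklore] -/
theorem sndF_inp : sndF (inp I d y) = y := by
  simp only [inp, sndF_boolPair]

/-- Value of `IC`. [folklore] -/
theorem IC_apply : IC (inp I d y) = I.encode := by
  simp only [IC, inp, Function.comp_apply, gapSVP_encode_eq, fstF_boolPair]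

/-- Value of `NUMF`: `dpEnc (num d)`. [folklore] -/
theorem NUMF_apply : NUMF (inp I d y) = dpEnc d.num := by
  simp only [NUMF, inp, Function.comp_apply, gapSVP_encode_eq, fstF_boolPair, sndF_boolPair]
  exact ofSMFn_encode d.num

/-- Value of `DENF`: `ival = den d`. [folklore] -/
theorem ival_DENF : ival (DENF (inp I d y)) = d.den := by
  simp only [DENF, inp, fanoutFn_apply, Function.comp_apply, gapSVP_encode_eq, fstF_boolPair, sndF_boolPair,
    ival, bitsToNat_encodeNat, bitsToNat_nil, Nat.cast_zero, sub_zero]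

/-- Value of `COINS`: the first `p(|code I|)` coins. [folklore] -/
theorem COINS_apply : COINS p (inp I d y) = y.take (p.eval I.encode.length) := by
  simp only [COINS, Function.comp_apply, fanoutFn_apply, IC_apply, sndF_inp, Plumb.takeFn_boolPair,
    Plumb.polyFn_apply, List.length_replicate]

/-- Value of `OUT`: the run of `R` on the instance code with those coins. [folklore] -/
theorem OUT_apply : OUT R p (inp I d y) = R.run I.encode (y.take (p.eval I.encode.length)) := by
  simp only [OUT, Function.comp_apply, fanoutFn_apply, IC_apply, COINS_apply, boolUnpair_boolPair,
    Function.uncurry_apply_pair]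

/-- Value of `A2`: `ival = num²`. [folklore] -/
theorem ival_A2 : ival (A2 (inp I d y)) = d.num * d.num := by
  simp only [A2, Function.comp_apply, fanoutFn_apply, zmulF_boolPair, NUMF_apply, ival_dpEnc]

variable {R p I d y} {D : ℕ} {U : Matrix (Fin I.n) (Fin I.n) ℤ}
  (hrun : R.run I.encode (y.take (p.eval I.encode.length)) =
    boolPair (encodeNat D) (LatticeInstance.encode ⟨I.n, U⟩))
include hrun

/-- Value of `DF` on a good answer: `ival = D`. [folklore] -/
theorem ival_DF : ival (DF R p (inp I d y)) = D := by
  simp only [DF, fanoutFn_apply, Function.comp_apply, OUT_apply, hrun, fstF_boolPair, sndF_boolPair, ival,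
    bitsToNat_encodeNat, bitsToNat_nil, Nat.cast_zero, sub_zero]

/-- Value of `MREC` on a good answer: the parsed matrix record. [folklore] -/
theorem MREC_apply : MREC R p (inp I d y) =
    boolPair (yardF (LatticeInstance.encode ⟨I.n, U⟩)) (boolPair (encodeNat I.n) (matCode U)) := by
  simp only [MREC, Function.comp_apply, OUT_apply, hrun, sndF_boolPair]
  exact parseF_encode ⟨I.n, U⟩

/-- Value of `TT` on a good answer: `ival = D² den²`. [folklore] -/
theorem ival_TT : ival (TT R p (inp I d y)) = (D : ℤ) * D * ((d.den : ℤ) * d.den) := by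
  simp only [TT, Function.comp_apply, fanoutFn_apply, zmulF_boolPair, ival_dpEnc, ival_DF hrun, ival_DENF]

/-- Value of the row test on a row of the answer. [folklore] -/
theorem dualRowTest_row (i : Fin I.n) :
    dualRowTest (boolPair (CTX R p (inp I d y)) (rowCode (U i))) =
      [decide ((D : ℤ) * D * ((d.den : ℤ) * d.den) ≤ d.num * d.num * ∑ t, U i t * U i t)] := by
  have hyard : I.n ≤ (yardF (LatticeInstance.encode ⟨I.n, U⟩)).length := by
    rw [length_yardF]
    exact (Nat.le_succ _).trans (budget_ge ⟨I.n, U⟩).1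
  simp only [dualRowTest, dualRowDot, CTX, Function.comp_apply, fanoutFn_apply, fstF_boolPair, sndF_boolPair,
    nthF_zero_boolPair, nthF_succ_boolPair, sndPow_succ_boolPair, sndPow_zero_boolPair, MREC_apply hrun,
    nthF_zero]
  rw [dotF_apply _ hyard, zmulF_boolPair, zleF_boolPair]
  simp only [ival_TT hrun, ival_dpEnc, ival_A2]

/-- **Value of the decider on a good answer**: the bit `[∃ i, D² den² ≤ num² ‖uᵢ‖²]`.
[cite: MicciancioRegev2007, proof of Thm. 5.23, first step (p. 29)] -/
theorem decF_apply : decF R p (inp I d y) =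
    [decide (∃ i : Fin I.n, (D : ℤ) * D * ((d.den : ℤ) * d.den) ≤ d.num * d.num * ∑ t, U i t * U i t)] := by
  have hrows : sndPow 1 (MREC R p (inp I d y)) = matCode U := by
    rw [MREC_apply hrun]; simp
  simp only [decF, Function.comp_apply, fanoutFn_apply, hrows, matCode]
  rw [anyFn_boolPair oneBit_dualRowTest, decNil_encList]
  have hiff : (∃ a ∈ List.ofFn (fun i => rowCode (U i)), dualRowTest (boolPair (CTX R p (inp I d y)) a) = [true]) ↔
      ∃ i : Fin I.n, (D : ℤ) * D * ((d.den : ℤ) * d.den) ≤ d.num * d.num * ∑ t, U i t * U i t := by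
    constructor
    · rintro ⟨a, ha, hca⟩
      rw [List.mem_ofFn] at ha
      obtain ⟨i, rfl⟩ := ha
      rw [dualRowTest_row hrun i] at hca
      exact ⟨i, of_decide_eq_true (List.cons.inj hca).1⟩
    · rintro ⟨i, hi⟩
      refine ⟨rowCode (U i), List.mem_ofFn.2 ⟨i, rfl⟩, ?_⟩
      rw [dualRowTest_row hrun i, decide_eq_true hi]
  simp only [hiff]

end Values

/-! #### The accepted language -/

/-- The language accepted by the decider. [folklore] -/
def decLang : Language Bool := {z | decF R p z = [true]}

/-- `decLang R p ∈ P` for a PPT `R`. [cite: AroraBarak2009, Def. 1.13 and §1.3] -/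
theorem decLang_mem_P (hR : IsPPT R id) : decLang R p ∈ Classes.P :=
  mem_P_of_mem_FP (decF_mem_FP R p hR) _ fun w =>
    ⟨fun h => h, fun h => by
      obtain ⟨b, hb⟩ := oneBit_decF R p w
      cases b
      · exact hb
      · exact absurd hb h⟩

end GIVPDual

/-! ### From a GIVP solver on the dual to `GapSVP` in promise-BPP -/

open GIVPDual

/-- The integer sum of squares of a row is the squared norm of the corresponding vector of `ℝⁿ`.
[folklore] -/
theorem cast_sum_mul_self_eq_norm_sq {n : ℕ} (u : Fin n → ℤ) :
    ((∑ t, u t * u t : ℤ) : ℝ) = ‖intVecToEuclidean n u‖ ^ 2 := by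
  rw [norm_intVecToEuclidean, Real.sq_sqrt (Finset.sum_nonneg fun _ _ => sq_nonneg _)]
  push_cast
  exact Finset.sum_congr rfl fun t _ => by ring

/-- **The integer test is the real test**: `D² den² ≤ num² ∑ₜ uₜ² ↔ D² den² ≤ num² ‖u‖²` (casts).
[folklore] -/
theorem intTest_iff {n : ℕ} (u : Fin n → ℤ) (D den : ℕ) (num : ℤ) :
    (D : ℤ) * D * ((den : ℤ) * den) ≤ num * num * ∑ t, u t * u t ↔
      (D : ℝ) ^ 2 * (den : ℝ) ^ 2 ≤ (num : ℝ) ^ 2 * ‖intVecToEuclidean n u‖ ^ 2 := by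
  rw [← cast_sum_mul_self_eq_norm_sq, ← Int.cast_le (R := ℝ)]
  push_cast
  constructor <;> intro h <;> nlinarith [h]

/-- **`GapSVP_γ` restricted to a dimension set is in promise-BPP, given a GIVP solver for the dual
lattices.** Let `R` be PPT with coin budget the polynomial `p`, and suppose that on the code of every
nonsingular instance `B` of dimension `n ∈ S'` (`S' ⊆ [1, ∞)`) it outputs with probability `≥ 2/3` a
good dual set of quality `g(n)` (`givpDualOutputs`), where `0 ≤ g(n)` and `g(n)√n ≤ γ(n)`. Then the
promise problem `GapSVP_γ` restricted to instances of dimension in `S'` lies in `PromiseBPP'`: the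
witness language is `decLang R p`, the coin polynomial is `p`; on a YES instance the good runs accept
(`gapSVP_dualTest_of_yes`), on a NO instance they reject (`gapSVP_dualTest_of_no`), and the good runs
have probability `≥ 2/3` among the coin strings (`RandAlg.pr_eq_uniformProb`, `uniformProb_take_of_le`).
[cite: MicciancioRegev2007, Lemma 3.2 and Cor. 5.13 (proof of Thm. 5.23, first step, p. 29)] -/
theorem gapSVP_restrict_mem_PromiseBPP'_of_givpDual {R : RandAlg (List Bool) (List Bool)}
    (hR : IsPPT R id) {p : Polynomial ℕ} (hcoin : ∀ k, R.coinLen k = p.eval k) {S' : Set ℕ}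
    {g γ : ℕ → ℝ} (hg : ∀ n, 0 ≤ g n) (hγ : ∀ n, g n * Real.sqrt n ≤ γ n) (hS1 : ∀ n ∈ S', 1 ≤ n)
    (hgood : ∀ I : LatticeInstance, I.IsNonsingular → I.n ∈ S' →
      (2 / 3 : ℝ) ≤ R.pr id I.encode (givpDualOutputs I (g I.n))) :
    PromiseProblem.ofEncoding gapSVPInstanceEncoding
        {q | q ∈ GapSVP.yes γ ∧ q.1.n ∈ S'} {q | q ∈ GapSVP.no γ ∧ q.1.n ∈ S'} ∈ PromiseBPP' := by
  refine ⟨decLang R p, decLang_mem_P R p hR, p, ?_, ?_⟩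
  · -- YES instances: good runs accept
    rintro x ⟨⟨I, d⟩, ⟨⟨hI, hd, hyes⟩, hS⟩, rfl⟩
    have hkle : p.eval I.encode.length ≤ p.eval (gapSVPInstanceEncoding.encode (I, d)).length := by
      refine TM2Iter.eval_mono p ?_
      rw [gapSVP_encode_eq, length_boolPair]
      omega
    have hpr : R.pr id I.encode (givpDualOutputs I (g I.n)) =
        uniformProb (p.eval I.encode.length) {r | R.run I.encode r ∈ givpDualOutputs I (g I.n)} := by
      rw [RandAlg.pr_eq_uniformProb, hcoin]; rfl
    calc (2 / 3 : ℝ) ≤ R.pr id I.encode (givpDualOutputs I (g I.n)) := hgood I hI hS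
      _ = uniformProb (p.eval (gapSVPInstanceEncoding.encode (I, d)).length)
            {y' | y'.take (p.eval I.encode.length) ∈ {r | R.run I.encode r ∈ givpDualOutputs I (g I.n)}} := by
          rw [hpr, uniformProb_take_of_le hkle]
      _ ≤ _ := PromiseCook.uniformProb_mono ?_
    intro y' hy'
    obtain ⟨D, U, hrun, hD, hmem, hli, -⟩ := hy'
    change decF R p (inp I d y') = [true]
    rw [decF_apply hrun]
    have hn : 1 ≤ I.n := hS1 _ hS
    have hspan : Submodule.span ℝ (Set.range fun i => intVecToEuclidean I.n (U i)) = ⊤ :=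
      hli.span_eq_top_of_card_eq_finrank' (by simp)
    have hnum : 0 ≤ d.num := Rat.num_nonneg.2 hd.le
    have hyes' : minNorm I.lattice ≤ (d.num : ℝ) / d.den := by
      convert hyes using 1
      rw [Rat.cast_def]
    obtain ⟨i, hi⟩ := LatticeInstance.gapSVP_dualTest_of_yes hI hn hD hmem hspan hnum d.den_pos hyes'
    simp only [List.cons.injEq, and_true, decide_eq_true_eq]
    exact ⟨i, (intTest_iff (U i) D d.den d.num).2 hi⟩
  · -- NO instances: good runs reject
    rintro x ⟨⟨I, d⟩, ⟨⟨hI, hd, hno⟩, hS⟩, rfl⟩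
    have hkle : p.eval I.encode.length ≤ p.eval (gapSVPInstanceEncoding.encode (I, d)).length := by
      refine TM2Iter.eval_mono p ?_
      rw [gapSVP_encode_eq, length_boolPair]
      omega
    have hpr : R.pr id I.encode (givpDualOutputs I (g I.n)) =
        uniformProb (p.eval I.encode.length) {r | R.run I.encode r ∈ givpDualOutputs I (g I.n)} := by
      rw [RandAlg.pr_eq_uniformProb, hcoin]; rfl
    calc (2 / 3 : ℝ) ≤ R.pr id I.encode (givpDualOutputs I (g I.n)) := hgood I hI hS
      _ = uniformProb (p.eval (gapSVPInstanceEncoding.encode (I, d)).length)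
            {y' | y'.take (p.eval I.encode.length) ∈ {r | R.run I.encode r ∈ givpDualOutputs I (g I.n)}} := by
          rw [hpr, uniformProb_take_of_le hkle]
      _ ≤ _ := PromiseCook.uniformProb_mono ?_
    intro y' hy'
    obtain ⟨D, U, hrun, hD, -, -, hbound⟩ := hy'
    change ¬ decF R p (inp I d y') = [true]
    rw [decF_apply hrun]
    have hn : 1 ≤ I.n := hS1 _ hS
    have hnum : 0 ≤ d.num := Rat.num_nonneg.2 hd.le
    have hno' : γ I.n * ((d.num : ℝ) / d.den) < minNorm I.lattice := by
      convert hno using 2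
      rw [Rat.cast_def]
    have hlt := fun i => LatticeInstance.gapSVP_dualTest_of_no hI hn hD (hg I.n) (hγ I.n) hbound hnum
      d.den_pos hno' i
    simp only [List.cons.injEq, and_true, decide_eq_true_eq, not_exists]
    intro i hi
    exact (not_le.2 (hlt i)) ((intTest_iff (U i) D d.den d.num).1 hi)

/-! ### The assembly: the target fact from Cor. 5.13 on the dual -/

/-- `8 β(n) n`-type factors are polynomially bounded when `β` is. [cite: AroraBarak2009, §1.6] -/
theorem isPolyBoundedReal_eight_mul_mul {β : ℕ → ℝ} (hβ : IsPolyBoundedReal β) :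
    IsPolyBoundedReal fun n => 8 * β n * n := by
  obtain ⟨q, hq⟩ := hβ
  refine ⟨C 8 * q * X, fun n => ?_⟩
  simp only [eval_mul, eval_C, eval_X, Nat.cast_mul, Nat.cast_ofNat]
  have hn : (0 : ℝ) ≤ n := Nat.cast_nonneg _
  exact mul_le_mul_of_nonneg_right (by linarith [hq n]) hn

/-- **The target fact from Micciancio–Regev's Corollary 5.13 applied to the dual lattice** (the
hypothesis is written inline; no named fact is introduced). HYPOTHESIS `h` = MR07 Cor. 5.13 (GIVP from
SIS on the average, authors' version p. 25: "for any polynomially bounded `β, m, q = n^{O(1)}`, any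
negligible `ε(n)`, and any `q(n) ≥ 8n√m β(n)`, there is a probabilistic polynomial time reduction from
solving GIVP^{η_ε}_{8β√n} in the worst case to solving SIS_{q,m,β} on the average with non-negligible
probability") exactly as it is INVOKED in the first step of the proof of Thm. 5.23 (p. 29: "using
Corollary 5.13 (with `F` as an oracle), we obtain a set of `n` linearly independent vectors `S` in
`L(B)*` such that `‖S‖ ≤ 8β√n η_ε(B*)`", with `ε = 2⁻ⁿ` and the SIS′ oracle `F`, which "also solves SIS"
(p. 28)), in the tree's rendering of the MR07 facts (`MicciancioRegev2007_gapCVP'_to_SIS'`): under the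
parameter hypotheses of Thm. 5.23 (`IsPolyTimeParams`, `MRModulusCondition` — which gives Cor. 5.13's
`q ≥ 8n√m β` from dimension `4` on, absorbed by `n₀`), for every PPT `B` solving SIS′_{q,m,β} on the average
with probability `≥ 1/n^c` on the dimensions `n ∈ S`, there is a PPT `R` with a polynomial coin budget
that, on the code of any nonsingular `B` of dimension `n ∈ S`, `n ≥ n₀`, outputs with probability `≥ 2/3`
a good dual set of quality `8β(n)√n` (`givpDualOutputs`). CONCLUSION: the named fact
`owfExist_of_gapSVP_worstCaseHard`. Proof: as `owfExist_of_gapSVP_worstCaseHard_of_MR07`, with Ajtai's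
SIS-function step discharged (`Ajtai1996_sisFunction_inverter_to_SIS'_holds`), the factor
`γ(n) = max 1 (8β(n) n)` and `gapSVP_restrict_mem_PromiseBPP'_of_givpDual` in place of Thm. 5.23; the
verifier part of Thm. 5.23 (§5.4) and Lemma 5.22 are not used.
[cite: MicciancioRegev2007, Cor. 5.13 with Lemma 3.2 (proof of Thm. 5.23, first step, p. 29); Ajtai 1996 Thm 1] -/
theorem owfExist_of_gapSVP_worstCaseHard_of_givpDual
    (h : ∀ (q m : ℕ → ℕ) [∀ n, NeZero (q n)] (β : ℕ → ℝ),
      IsPolyBounded q → IsPolyBounded m → IsPolyBoundedReal β → IsPolyTimeParams q β m →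
      (∀ n, 0 < β n) → MRModulusCondition q m β →
      ∀ B : RandAlg (List Bool) (List Bool), IsPPT B id → ∀ (c : ℕ) (S : Set ℕ),
        (∀ n ∈ S, 1 / (n : ℝ) ^ c ≤ SIS.successProb' B n (m n) (q n) (β n)) →
        ∃ R : RandAlg (List Bool) (List Bool), IsPPT R id ∧
          (∃ p : Polynomial ℕ, ∀ k, R.coinLen k = p.eval k) ∧
          ∃ n₀ : ℕ, ∀ I : LatticeInstance, I.IsNonsingular → I.n ∈ S → n₀ ≤ I.n →
            (2 / 3 : ℝ) ≤ R.pr id I.encode (givpDualOutputs I (8 * β I.n * Real.sqrt I.n))) :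
    owfExist_of_gapSVP_worstCaseHard := by
  intro H
  obtain ⟨q, m, hq0, β, g, nOf, hq, hm, hβ, hpar, hβ1, hmod, hg, hnOf, hred⟩ :=
    Ajtai1996_sisFunction_inverter_to_SIS'_holds
  refine ⟨g, hg, fun A hA => ?_⟩
  by_contra hneg
  -- a polynomial inverse lower bound on an infinite set of security parameters
  obtain ⟨c, hK⟩ := exists_infinite_ge_inv_pow_of_not_superpolynomialDecay
    (fun k => invertProb_nonneg g A k) hneg
  set K : Set ℕ := {k : ℕ | 1 / (k : ℝ) ^ c ≤ invertProb g A k} with hKdef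
  -- (F2) an average-case SIS′ solver on the corresponding dimensions
  obtain ⟨B, hB, c', k₀, hsolve⟩ := hred A hA c
  set S : Set ℕ := nOf '' (K ∩ Set.Ici k₀) with hSdef
  have hSinf : S.Infinite := infinite_image_of_tendsto_atTop hnOf (infinite_inter_Ici hK k₀)
  have hS : ∀ n ∈ S, 1 / (n : ℝ) ^ c' ≤ SIS.successProb' B n (m n) (q n) (β n) := by
    rintro n ⟨k, ⟨hkK, hk₀⟩, rfl⟩
    exact hsolve k hk₀ hkK
  -- (Cor. 5.13 on the dual) a GIVP solver for the dual lattices of instances of dimension in `S`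
  have hβ0 : ∀ n, 0 < β n := fun n => one_pos.trans_le (hβ1 n)
  obtain ⟨R, hR, ⟨pR, hpR⟩, n₀, hgood⟩ := h q m β hq hm hβ hpar hβ0 hmod B hB c' S hS
  -- the factor `γ = max 1 (8 β n · n)` and the dimension set `S ∩ [max n₀ 1, ∞)`
  set γ : ℕ → ℝ := fun n => max 1 (8 * β n * n) with hγdef
  have hγpoly : IsPolyBoundedReal γ :=
    isPolyBoundedReal_max_one (isPolyBoundedReal_eight_mul_mul hβ)
  set S' : Set ℕ := S ∩ Set.Ici (max n₀ 1) with hS'def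
  have hmem : PromiseProblem.ofEncoding gapSVPInstanceEncoding
      {q | q ∈ GapSVP.yes γ ∧ q.1.n ∈ S'} {q | q ∈ GapSVP.no γ ∧ q.1.n ∈ S'} ∈ PromiseBPP' := by
    refine gapSVP_restrict_mem_PromiseBPP'_of_givpDual hR hpR (g := fun n => 8 * β n * Real.sqrt n)
      (γ := γ) (fun n => by have := (hβ0 n).le; positivity) (fun n => ?_) (fun n hn => ?_) ?_
    · calc 8 * β n * Real.sqrt n * Real.sqrt n = 8 * β n * n := by
            rw [mul_assoc, Real.mul_self_sqrt (Nat.cast_nonneg _)]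
        _ ≤ γ n := le_max_right _ _
    · exact le_trans (le_max_right _ _) hn.2
    · intro I hI hIS
      exact hgood I hI hIS.1 (le_trans (le_max_left _ _) hIS.2)
  exact H γ hγpoly (fun n => le_max_left _ _) S' (infinite_inter_Ici hSinf _) hmem

end Literature.Computability.Cryptography

end
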